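import Summits.HodgeConjecture.HodgeConjecture.Theorems.CYFormCasimirCYFormSquarePrincipleGraph
import Literature.AlgebraicGeometry.HodgeTheory.HodgeTypeExteriorProduct
import HarnessLib

/-!
# Crux X1 `CYFormCarrierEight` (route `CYFormCasimir`, stmt-HodgeConjecture-23493), helper file 6:
# Galois-equivariant operators are rational on `W_K ⊗ ℂ`, and the rational operator `J = ± i√d` on `⋀⁴W ⊕ ⋀⁴W^*`

research route conditional on HC_CM; not a corollary. Nothing here proves HC, HC_CM, the rung H2, X1 or `stub_cyform_exists`;
step S4 of `Cruxes/CYFormCarrierEight/STUB-PLAN-stub_cyform_exists.md` (operator criterion: helper file 4).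

* `isRationalClass_apply_of_coeffClass_comm` — if a `ℂ`-linear `s` on `H⁴(A(ℂ); ℂ)` commutes with every coefficient twist
  `σ_*`, `σ ∈ Aut(ℂ)`, on `W_K ⊗ ℂ = weilClassesOf A φ 2 d`, then `s` maps the RATIONAL classes of `W_K ⊗ ℂ` to rational
  classes (Galois descent for single classes, X3's `isRationalClass_of_forall_coeffClass_eq`). This is the `hrat` hypothesis of
  the operator criterion, reduced to equivariance.
* `exists_ratOperator_I_sqrt` — there is a `ℂ`-linear `J` on `H⁴(A(ℂ); ℂ)`, a `ℚ`-combination of `𝟙` and ONE test pull-back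
  `((d+1)·𝟙 + φ)^*`, acting as `+i√d` on `⋀⁴W` and as `-i√d` on `⋀⁴W^*`, mapping rational classes to rational classes,
  preserving Hodge types, and commuting with every `σ_*` (so "multiply by `c = p + q i√d ∈ K` on `⋀⁴W` and by `c̄` on `⋀⁴W^*`"
  is the rational operator `p·𝟙 + q·J` — the rescaling freedom of the Hodge star used in S4).

References: Deligne1982HodgeCycles (I §3), vanGeemen1994HodgeAV (4.9), FriedmanLaza2013 (§3.5).
-/

-- `Summit.HodgeConjecture.HodgeConjecture.…` is the tree's mandated summit/problem namespace (single-problem summit).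
set_option linter.dupNamespace false
noncomputable section

open CategoryTheory
open Literature.AlgebraicTopology.SingularHomology
open Literature.AlgebraicGeometry.Motives
open Literature.AlgebraicGeometry.HodgeTheory

namespace Summit.HodgeConjecture.HodgeConjecture.Theorems.CYFormCarrier

section Descent

variable {A : AbelianVariety ℂ} {d : ℕ} {φ : A ⟶ A}

/-- **A Galois-equivariant operator on `W_K ⊗ ℂ` maps rational classes to rational classes**: if `σ_* (s c) = s (σ_* c)` for
all `σ ∈ Aut(ℂ)` and all `c ∈ weilClassesOf A φ 2 d`, then `s c` is rational for every rational `c ∈ weilClassesOf A φ 2 d`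
(`σ_* c = c` for rational `c`, so `s c` is fixed by every `σ_*`, hence rational). [cite: Deligne1982HodgeCycles, I §3] -/
theorem isRationalClass_apply_of_coeffClass_comm (hA : A.dim = 2 * 4)
    (s : complexBetti A.X (2 * 2) →ₗ[ℂ] complexBetti A.X (2 * 2))
    (hs : ∀ σ : ℂ ≃+* ℂ, ∀ c ∈ weilClassesOf A φ 2 d,
      coeffClass (R := ℂ) (S := ℂ) σ.toRingHom.toAddMonoidHom (2 * 2) (s c) =
        s (coeffClass (R := ℂ) (S := ℂ) σ.toRingHom.toAddMonoidHom (2 * 2) c)) :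
    ∀ c ∈ weilClassesOf A φ 2 d, IsRationalClass c → IsRationalClass (s c) := by
  intro c hc hcr
  refine CYFormSquare.isRationalClass_of_forall_coeffClass_eq (isSmoothProjective_of_dim_eq' hA) fun σ ↦ ?_
  rw [hs σ c hc, hcr.coeffClass_ringHom_eq]

end Descent

section RatOperator

variable {A : AbelianVariety ℂ} {d : ℕ} {φ : A ⟶ A}

/-- The binomial expansion `(x + s)⁴ = (x⁴ - 6dx² + d²) + 4x(x² - d)·s` for `s² = -d`. [folklore] -/
theorem natCast_add_pow_four (x : ℕ) (d : ℕ) {s : ℂ} (hs : s ^ 2 = -(d : ℂ)) :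
    ((x : ℂ) + s) ^ 4 = ((x : ℂ) ^ 4 - 6 * d * x ^ 2 + d ^ 2) + (4 * x * (x ^ 2 - d)) * s := by
  have h4 : s ^ 4 = (d : ℂ) ^ 2 := by rw [show (4 : ℕ) = 2 * 2 from rfl, pow_mul, hs]; ring
  have h3 : s ^ 3 = -(d : ℂ) * s := by rw [pow_succ, hs]
  linear_combination (4 * (x : ℂ)) * h3 + h4 + 6 * (x : ℂ) ^ 2 * hs

/-- **The rational operator `J = ± i√d` on `⋀⁴W ⊕ ⋀⁴W^*`.** For `φ ≫ φ = -d` on a complex abelian variety of dimension `8`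
there is a `ℂ`-linear `J` on `H⁴(A(ℂ); ℂ)` — namely `J = b⁻¹ · (((d+1)·𝟙 + φ)^* - a·𝟙)` with the integers
`a + b i√d = (d + 1 + i√d)⁴`, `b = 4(d+1)((d+1)² - d) ≠ 0` — such that `J = i√d` on `weilClassesPlus A φ 2 d`, `J = -i√d` on
`weilClassesMinus A φ 2 d`, `J` maps rational classes to rational classes, preserves Hodge types, and commutes with every
coefficient twist `σ_*`. [cite: vanGeemen1994HodgeAV, 4.9] [cite: Deligne1982HodgeCycles, I §3] -/
theorem exists_ratOperator_I_sqrt (hA : A.dim = 2 * 4) :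
    ∃ J : complexBetti A.X (2 * 2) →ₗ[ℂ] complexBetti A.X (2 * 2),
      (∀ c ∈ weilClassesPlus A φ 2 d, J c = (Complex.I * (Real.sqrt d : ℂ)) • c) ∧
      (∀ c ∈ weilClassesMinus A φ 2 d, J c = -(Complex.I * (Real.sqrt d : ℂ)) • c) ∧
      (∀ c, IsRationalClass c → IsRationalClass (J c)) ∧
      (∀ p q : ℕ, ∀ c, IsOfHodgeType (2 * 4) A.X (2 * 2) p q c → IsOfHodgeType (2 * 4) A.X (2 * 2) p q (J c)) ∧
      (∀ τ : ℂ →+* ℂ, ∀ c, coeffClass (R := ℂ) (S := ℂ) τ.toAddMonoidHom (2 * 2) (J c) =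
        J (coeffClass (R := ℂ) (S := ℂ) τ.toAddMonoidHom (2 * 2) c)) := by
  have hX : IsSmoothProjective (2 * 4) A.X := isSmoothProjective_of_dim_eq' hA
  set s : ℂ := Complex.I * (Real.sqrt d : ℂ) with hs_def
  have hs2 : s ^ 2 = -(d : ℂ) := I_mul_sqrt_sq d
  set x : ℕ := d + 1 with hx
  -- the integers `a`, `b`
  set aQ : ℚ := (x : ℚ) ^ 4 - 6 * d * x ^ 2 + d ^ 2 with haQ
  set bQ : ℚ := 4 * x * ((x : ℚ) ^ 2 - d) with hbQ
  have hb0 : bQ ≠ 0 := by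
    have hx1 : (0 : ℚ) < x := by positivity
    have hxd : (d : ℚ) < (x : ℚ) ^ 2 := by
      have : (d : ℚ) + 1 ≤ (x : ℚ) := by rw [hx]; push_cast; exact le_rfl
      nlinarith
    rw [hbQ]; exact mul_ne_zero (mul_ne_zero four_ne_zero hx1.ne') (sub_ne_zero.2 hxd.ne')
  have hplus : ((x : ℂ) + ((1 : ℕ) : ℂ) * Complex.I * (Real.sqrt d : ℂ)) ^ (2 * 2) = (aQ : ℂ) + (bQ : ℂ) * s := by
    rw [Nat.cast_one, one_mul, ← hs_def, show 2 * 2 = 4 from rfl, natCast_add_pow_four x d hs2, haQ, hbQ]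
    push_cast; ring
  have hminus : ((x : ℂ) - ((1 : ℕ) : ℂ) * Complex.I * (Real.sqrt d : ℂ)) ^ (2 * 2) = (aQ : ℂ) - (bQ : ℂ) * s := by
    have hs2' : (-s) ^ 2 = -(d : ℂ) := by rw [neg_sq, hs2]
    rw [Nat.cast_one, one_mul, ← hs_def, sub_eq_add_neg, show 2 * 2 = 4 from rfl, natCast_add_pow_four x d hs2',
      haQ, hbQ]
    push_cast; ring
  -- the operator
  set P : complexBetti A.X (2 * 2) →ₗ[ℂ] complexBetti A.X (2 * 2) :=
    (complexBetti.map (x • 𝟙 A + (1 : ℕ) • φ).hom.hom.hom (2 * 2)).hom with hP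
  refine ⟨((bQ : ℂ)⁻¹) • (P - (aQ : ℂ) • LinearMap.id), ?_, ?_, ?_, ?_, ?_⟩
  · intro c hc
    have h := (mem_weilClassesPlus_iff.1 hc) x 1
    change P c = _ at h
    rw [hplus] at h
    rw [LinearMap.smul_apply, LinearMap.sub_apply, LinearMap.smul_apply, LinearMap.id_apply, h, add_smul, add_sub_cancel_left,
      smul_smul, ← mul_assoc, inv_mul_cancel₀ (by exact_mod_cast hb0), one_mul]
  · intro c hc
    have h := (mem_weilClassesMinus_iff.1 hc) x 1
    change P c = _ at h
    rw [hminus] at h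
    rw [LinearMap.smul_apply, LinearMap.sub_apply, LinearMap.smul_apply, LinearMap.id_apply, h, sub_smul, sub_sub_cancel_left,
      ← neg_smul, smul_smul, mul_neg, ← mul_assoc, inv_mul_cancel₀ (by exact_mod_cast hb0), one_mul]
  · intro c hc
    rw [LinearMap.smul_apply, LinearMap.sub_apply, LinearMap.smul_apply, LinearMap.id_apply, ← Rat.cast_inv]
    refine IsRationalClass.smul ?_ _
    have h1 : IsRationalClass (P c) := hc.map _
    have h2 := h1.add ((hc.smul aQ).smul (-1 : ℚ))
    rwa [Rat.cast_neg, Rat.cast_one, neg_one_smul, ← sub_eq_add_neg] at h2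
  · intro p q c hc
    rw [LinearMap.smul_apply, LinearMap.sub_apply, LinearMap.smul_apply, LinearMap.id_apply]
    exact ((hc.map_of_isSmoothProjective hX hX _).sub hX (hc.smul _)).smul _
  · intro τ c
    rw [LinearMap.smul_apply, LinearMap.sub_apply, LinearMap.smul_apply, LinearMap.id_apply, LinearMap.smul_apply,
      LinearMap.sub_apply, LinearMap.smul_apply, LinearMap.id_apply, coeffClass_ringHom_smul, map_sub,
      coeffClass_ringHom_smul, map_ratCast, ← Rat.cast_inv, map_ratCast]
    congr 2
    exact coeffClass_map _ _ c

end RatOperator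

end Summit.HodgeConjecture.HodgeConjecture.Theorems.CYFormCarrier

end
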